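import Literature.Computability.AlgebraicComplexity.QuantumFunctionals
import HarnessLib

/-!
# Maximisers of the weighted marginal entropy `H_θ` on a support: existence and first-order conditions

Topic: `Literature/Computability/AlgebraicComplexity` (support file for Strassen's support functionals,
`QuantumFunctionals.lean`). For `θ ∈ P([3])` and a nonempty `Φ ⊆ ι × κ × μ` the quantity
`H_θ(Φ) = max_{P ∈ P(Φ)} θ(1) H(P₁) + θ(2) H(P₂) + θ(3) H(P₃)` (`maxWeightedEntropy`, CVZ Def. 2.2) is a
maximum of a continuous concave function over a compact convex set. This file proves the elementary
convex-analysis facts about a maximiser `P*` that Strassen's comparison of the upper and lower support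
functionals rests on ([Str91, §2–4]; [CVZ23, Prop. 2.6 and Thm. 2.15], where the proofs are referred to
[Str91]):

* `exists_isMaxOn_weightedEntropy` — a maximiser exists (compactness of the feasible set
  `{P ∈ stdSimplex | supp P ⊆ Φ}`, continuity of `H_θ`), and `maxWeightedEntropy_eq_of_isMaxOn`;
  `weightedEntropy_le_maxWeightedEntropy`, `maxWeightedEntropy_le_card` (the `sSup` is genuine).
* `IsMaxOn.marginal_pos_and_score_le` — **first-order (KKT) conditions at a maximiser `P*`:**
  (a) every marginal with positive weight `θ(i) > 0` is positive on the `i`-th projection of `Φ`;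
  (b) for every `x ∈ Φ` the *score* `∑ᵢ θ(i) log₂ (1 / P*ᵢ(xᵢ))` is at most `H_θ(P*)`.
  Both follow by comparing `P*` with the perturbation `(1 - ε) P* + ε δ_x` for small `ε > 0`, using
  the three one-variable estimates `sum_negMulLog_perturb_ge` (concavity),
  `sum_negMulLog_perturb_ge_of_eq_zero` (`+ ε log (1/ε)` gain at a zero of the marginal) and
  `sum_negMulLog_perturb_ge_of_pos` (first-order expansion with an `O(ε²)` remainder, from
  `log u ≤ u - 1`); the `ε`-bookkeeping is isolated in `kkt_of_perturbation_bounds`.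
* `shannonEntropy_le_sum_mul_neg_logb` — Gibbs' inequality `H(P) ≤ ∑ P log₂(1/Q)` for a
  sub-probability vector `Q` positive on `supp P`, and its weighted three-marginal form
  `weightedEntropy_le_sum_mul_score`.

Together (b) and Gibbs' inequality say that the marginals of `P*` are optimal dual variables:
`H_θ(Φ) = min_Q max_{x ∈ Φ} ∑ᵢ θ(i) log₂(1/Qᵢ(xᵢ))`; only the two inequalities above are vendored.
Entropies are in bits as in `QuantumFunctionals.lean`; the one-variable estimates are stated in nats
(`∑ negMulLog`). No new definitions are introduced (perturbations are written out as
`fun y => (1 - ε) * P y + ε * (if y = x then 1 else 0)`).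

References: V. Strassen, *Degeneration and complexity of bilinear maps: some asymptotic spectra*,
J. reine angew. Math. 413 (1991), 127–180; M. Christandl, P. Vrana, J. Zuiddam, *Universal points in
the asymptotic spectrum of tensors*, J. Amer. Math. Soc. 36 (2023), §2.
-/

noncomputable section

open scoped BigOperators
open Real (negMulLog)

namespace Literature.Computability.AlgebraicComplexity

/-! ## Gibbs' inequality -/

section Gibbs

variable {α : Type*} [Fintype α]

/-- Pointwise Gibbs inequality `-p log p + p log q ≤ q - p` for `p, q ≥ 0` with `q > 0` whenever
`p > 0` (from `log u ≤ u - 1`). [folklore] -/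
theorem negMulLog_add_mul_log_le {p q : ℝ} (hp : 0 ≤ p) (hq : 0 ≤ q) (hpq : p ≠ 0 → 0 < q) :
    negMulLog p + p * Real.log q ≤ q - p := by
  rcases hp.eq_or_lt with h | hp'
  · rw [← h]
    simp [hq]
  · have hq' : 0 < q := hpq hp'.ne'
    have h1 : Real.log (q / p) ≤ q / p - 1 := Real.log_le_sub_one_of_pos (div_pos hq' hp')
    rw [Real.log_div hq'.ne' hp'.ne'] at h1
    have h2 : p * (Real.log q - Real.log p) ≤ p * (q / p - 1) := mul_le_mul_of_nonneg_left h1 hp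
    have h3 : p * (q / p - 1) = q - p := by field_simp
    have h4 : negMulLog p + p * Real.log q = p * (Real.log q - Real.log p) := by
      simp only [Real.negMulLog]; ring
    linarith

/-- **Gibbs' inequality** (nats): for a probability vector `P` and a sub-probability vector `Q ≥ 0`,
`∑ Q ≤ 1`, positive wherever `P` is, `-∑ P log P ≤ -∑ P log Q`. [folklore] -/
theorem sum_negMulLog_le_sum_mul_neg_log {P Q : α → ℝ} (hP0 : ∀ x, 0 ≤ P x) (hP1 : ∑ x, P x = 1)
    (hQ0 : ∀ x, 0 ≤ Q x) (hQ1 : ∑ x, Q x ≤ 1) (hPQ : ∀ x, P x ≠ 0 → 0 < Q x) :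
    ∑ x, negMulLog (P x) ≤ ∑ x, P x * (-Real.log (Q x)) := by
  have h : ∑ x, (negMulLog (P x) + P x * Real.log (Q x)) ≤ ∑ x, (Q x - P x) :=
    Finset.sum_le_sum fun x _ => negMulLog_add_mul_log_le (hP0 x) (hQ0 x) (hPQ x)
  rw [Finset.sum_add_distrib, Finset.sum_sub_distrib, hP1] at h
  have h' : ∑ x, P x * (-Real.log (Q x)) = -∑ x, P x * Real.log (Q x) := by
    rw [← Finset.sum_neg_distrib]
    exact Finset.sum_congr rfl fun x _ => by ring
  linarith

/-- **Gibbs' inequality** in bits: `H(P) ≤ ∑ₓ P(x) log₂ (1/Q(x))` for `P` a probability vector and `Q`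
a nonnegative sub-probability vector positive on `supp P`. [folklore] -/
theorem shannonEntropy_le_sum_mul_neg_logb {P Q : α → ℝ} (hP0 : ∀ x, 0 ≤ P x) (hP1 : ∑ x, P x = 1)
    (hQ0 : ∀ x, 0 ≤ Q x) (hQ1 : ∑ x, Q x ≤ 1) (hPQ : ∀ x, P x ≠ 0 → 0 < Q x) :
    shannonEntropy P ≤ ∑ x, P x * (-Real.log (Q x) / Real.log 2) := by
  rw [shannonEntropy_def]
  have h2 : 0 < Real.log 2 := Real.log_pos one_lt_two
  calc (∑ x, negMulLog (P x)) / Real.log 2 ≤ (∑ x, P x * (-Real.log (Q x))) / Real.log 2 :=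
        div_le_div_of_nonneg_right (sum_negMulLog_le_sum_mul_neg_log hP0 hP1 hQ0 hQ1 hPQ) h2.le
    _ = ∑ x, P x * (-Real.log (Q x) / Real.log 2) := by
        rw [Finset.sum_div]
        exact Finset.sum_congr rfl fun x _ => by ring

end Gibbs

/-! ## One-variable perturbation estimates for `-∑ p log p` along `(1 - ε) p + ε δ_z` -/

section Perturb

variable {α : Type*} [Fintype α] [DecidableEq α]

/-- Concavity: `H((1-ε) p + ε δ_z) ≥ (1 - ε) H(p)` (nats), for `p ≥ 0` and `0 ≤ ε ≤ 1`. [folklore] -/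
theorem sum_negMulLog_perturb_ge {p q : α → ℝ} {z : α} {ε : ℝ} (hp0 : ∀ y, 0 ≤ p y)
    (hε0 : 0 ≤ ε) (hε1 : ε ≤ 1)
    (hq : ∀ y, q y = (1 - ε) * p y + ε * (if y = z then 1 else 0)) :
    (1 - ε) * ∑ y, negMulLog (p y) ≤ ∑ y, negMulLog (q y) := by
  rw [Finset.mul_sum]
  refine Finset.sum_le_sum fun y _ => ?_
  have hδ0 : (0 : ℝ) ≤ (if y = z then 1 else 0) := by split_ifs <;> norm_num
  have hδ : negMulLog (if y = z then (1 : ℝ) else 0) = 0 := by split_ifs <;> simp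
  have h := Real.concaveOn_negMulLog.2 (Set.mem_Ici.2 (hp0 y)) (Set.mem_Ici.2 hδ0)
    (show (0 : ℝ) ≤ 1 - ε by linarith) hε0 (by ring)
  simp only [smul_eq_mul, hδ, mul_zero, add_zero] at h
  rw [hq y]
  exact h

/-- At a zero of `p`: `H((1-ε) p + ε δ_z) ≥ (1 - ε) H(p) + ε log (1/ε)` (nats), for `p ≥ 0`, `p(z) = 0`,
`0 ≤ ε ≤ 1`. [folklore] -/
theorem sum_negMulLog_perturb_ge_of_eq_zero {p q : α → ℝ} {z : α} {ε : ℝ} (hp0 : ∀ y, 0 ≤ p y)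
    (hz : p z = 0) (hε0 : 0 ≤ ε) (hε1 : ε ≤ 1)
    (hq : ∀ y, q y = (1 - ε) * p y + ε * (if y = z then 1 else 0)) :
    (1 - ε) * ∑ y, negMulLog (p y) + negMulLog ε ≤ ∑ y, negMulLog (q y) := by
  have key : ∀ y, (1 - ε) * negMulLog (p y) + (if y = z then negMulLog ε else 0) ≤
      negMulLog (q y) := by
    intro y
    by_cases hyz : y = z
    · subst hyz
      rw [hq y, if_pos rfl, if_pos rfl, hz]
      simp
    · rw [if_neg hyz, add_zero, hq y, if_neg hyz, mul_zero, add_zero, Real.negMulLog_mul]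
      have : 0 ≤ p y * negMulLog (1 - ε) :=
        mul_nonneg (hp0 y) (Real.negMulLog_nonneg (by linarith) (by linarith))
      linarith
  calc (1 - ε) * ∑ y, negMulLog (p y) + negMulLog ε
      = ∑ y, ((1 - ε) * negMulLog (p y) + (if y = z then negMulLog ε else 0)) := by
        rw [Finset.sum_add_distrib, Finset.mul_sum, Finset.sum_ite_eq' Finset.univ z,
          if_pos (Finset.mem_univ _)]
    _ ≤ ∑ y, negMulLog (q y) := Finset.sum_le_sum fun y _ => key y

/-- At a point of positive mass: first-order expansion with quadratic remainder,
`H((1-ε) p + ε δ_z) ≥ (1 - ε) H(p) + ε log (1/p(z)) - c ε²` (nats) with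
`c = ∑_{p(y) > 0} (δ_z(y) - p(y))² / p(y)`, for a probability vector `p` with `p(z) > 0` and
`0 ≤ ε < 1` (from `log u ≤ u - 1`). [folklore] -/
theorem sum_negMulLog_perturb_ge_of_pos {p q : α → ℝ} {z : α} {ε : ℝ} (hp0 : ∀ y, 0 ≤ p y)
    (hp1 : ∑ y, p y = 1) (hz : 0 < p z) (hε0 : 0 ≤ ε) (hε1 : ε < 1)
    (hq : ∀ y, q y = (1 - ε) * p y + ε * (if y = z then 1 else 0)) :
    (1 - ε) * ∑ y, negMulLog (p y) + ε * (-Real.log (p z)) -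
        ε ^ 2 * ∑ y, (if p y = 0 then 0 else ((if y = z then 1 else 0) - p y) ^ 2 / p y) ≤
      ∑ y, negMulLog (q y) := by
  -- pointwise estimate
  have key : ∀ y, (1 - ε) * negMulLog (p y) + ε * ((if y = z then 1 else 0) * -Real.log (p y)) -
      ε * ((if y = z then 1 else 0) - p y) -
      ε ^ 2 * (if p y = 0 then 0 else ((if y = z then 1 else 0) - p y) ^ 2 / p y) ≤
      negMulLog (q y) := by
    intro y
    by_cases hy : p y = 0
    · have hyz : y ≠ z := fun h => hz.ne' (by rw [← h]; exact hy)
      have hqy : q y = 0 := by rw [hq y, hy, if_neg hyz]; ring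
      simp [hy, hqy, if_neg hyz]
    · have hpy : 0 < p y := lt_of_le_of_ne (hp0 y) (Ne.symm hy)
      have hδ0 : (0 : ℝ) ≤ (if y = z then 1 else 0) := by split_ifs <;> norm_num
      have hqy : 0 < q y := by
        rw [hq y]
        have : 0 < (1 - ε) * p y := mul_pos (by linarith) hpy
        nlinarith
      have hlog : Real.log (q y / p y) ≤ q y / p y - 1 :=
        Real.log_le_sub_one_of_pos (div_pos hqy hpy)
      rw [Real.log_div hqy.ne' hpy.ne'] at hlog
      have h1 : q y * (-Real.log (p y)) - q y * (q y / p y - 1) ≤ negMulLog (q y) := by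
        have := mul_le_mul_of_nonneg_left hlog hqy.le
        have e : negMulLog (q y) = q y * (-Real.log (q y)) := by simp only [Real.negMulLog]; ring
        rw [e]
        nlinarith
      have h2 : q y * (q y / p y - 1) =
          ε * ((if y = z then 1 else 0) - p y) +
            ε ^ 2 * (((if y = z then 1 else 0) - p y) ^ 2 / p y) := by
        rw [hq y]
        field_simp
        ring
      have h3 : q y * (-Real.log (p y)) =
          (1 - ε) * negMulLog (p y) + ε * ((if y = z then 1 else 0) * -Real.log (p y)) := by
        rw [hq y]
        simp only [Real.negMulLog]
        ring
      rw [if_neg hy]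
      linarith
  have hsum := Finset.sum_le_sum fun y (_ : y ∈ Finset.univ) => key y
  -- evaluate the sum of the pointwise lower bounds
  have e1 : ∑ y, ε * ((if y = z then (1 : ℝ) else 0) * -Real.log (p y)) = ε * -Real.log (p z) := by
    rw [← Finset.mul_sum]
    congr 1
    simp [ite_mul, Finset.sum_ite_eq']
  have e2 : ∑ y, ε * ((if y = z then (1 : ℝ) else 0) - p y) = 0 := by
    rw [← Finset.mul_sum, Finset.sum_sub_distrib, hp1, Finset.sum_ite_eq' Finset.univ z,
      if_pos (Finset.mem_univ _)]
    ring
  have e3 : ∑ y, ((1 - ε) * negMulLog (p y) + ε * ((if y = z then 1 else 0) * -Real.log (p y)) -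
      ε * ((if y = z then 1 else 0) - p y) -
      ε ^ 2 * (if p y = 0 then 0 else ((if y = z then 1 else 0) - p y) ^ 2 / p y)) =
      (1 - ε) * ∑ y, negMulLog (p y) + ε * (-Real.log (p z)) - 0 -
        ε ^ 2 * ∑ y, (if p y = 0 then 0 else ((if y = z then 1 else 0) - p y) ^ 2 / p y) := by
    rw [Finset.sum_sub_distrib, Finset.sum_sub_distrib, Finset.sum_add_distrib, e1, e2,
      Finset.mul_sum, Finset.mul_sum]
  rw [e3, sub_zero] at hsum
  exact hsum

/-- The remainder constant in `sum_negMulLog_perturb_ge_of_pos` is nonnegative. [folklore] -/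
theorem perturb_remainder_nonneg (p : α → ℝ) (hp0 : ∀ y, 0 ≤ p y) (z : α) :
    0 ≤ ∑ y, (if p y = 0 then 0 else ((if y = z then (1 : ℝ) else 0) - p y) ^ 2 / p y) :=
  Finset.sum_nonneg fun y _ => by
    split_ifs with h
    · exact le_rfl
    · exact div_nonneg (sq_nonneg _) (hp0 y)
    · exact div_nonneg (sq_nonneg _) (hp0 y)

/-- **The `ε`-bookkeeping of the first-order conditions.** Abstract form: weights `θ ≥ 0` on a finite
index set, "entropies" `Hn i`, "point masses" `pz i ≥ 0`, remainder constants `c i ≥ 0`, and perturbed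
entropies `N i ε` satisfying the three one-variable estimates of this file and the optimality inequality
`∑ θᵢ Nᵢ(ε) ≤ ∑ θᵢ Hnᵢ` for all `0 < ε < 1`. Then `θᵢ > 0 ⇒ pzᵢ > 0`, and
`∑ θᵢ log (1/pzᵢ) ≤ ∑ θᵢ Hnᵢ`. [folklore] -/
theorem kkt_of_perturbation_bounds {I : Type*} [Fintype I] {θ Hn pz c : I → ℝ} {N : I → ℝ → ℝ}
    (hθ : ∀ i, 0 ≤ θ i) (hpz : ∀ i, 0 ≤ pz i) (hc : ∀ i, 0 ≤ c i) (hHn : 0 ≤ ∑ i, θ i * Hn i)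
    (hopt : ∀ ε, 0 < ε → ε < 1 → ∑ i, θ i * N i ε ≤ ∑ i, θ i * Hn i)
    (hC : ∀ i ε, 0 < ε → ε < 1 → (1 - ε) * Hn i ≤ N i ε)
    (hB : ∀ i ε, 0 < ε → ε < 1 → pz i = 0 → (1 - ε) * Hn i + negMulLog ε ≤ N i ε)
    (hA : ∀ i ε, 0 < ε → ε < 1 → 0 < pz i →
      (1 - ε) * Hn i + ε * (-Real.log (pz i)) - ε ^ 2 * c i ≤ N i ε) :
    (∀ i, 0 < θ i → 0 < pz i) ∧ ∑ i, θ i * (-Real.log (pz i)) ≤ ∑ i, θ i * Hn i := by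
  classical
  set M := ∑ i, θ i * Hn i with hM
  -- (a) positivity of the point masses with positive weight
  have hposi : ∀ i, 0 < θ i → 0 < pz i := by
    intro i₀ hθi
    by_contra hnot
    have hz : pz i₀ = 0 := le_antisymm (not_lt.1 hnot) (hpz i₀)
    set ε := Real.exp (-(M + 1) / θ i₀) with hε
    have hε0 : 0 < ε := Real.exp_pos _
    have hε1 : ε < 1 := Real.exp_lt_one_iff.mpr (div_neg_of_neg_of_pos (by linarith) hθi)
    have hlogε : Real.log ε = -(M + 1) / θ i₀ := Real.log_exp _
    -- lower bound on `∑ θ N`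
    have hlow : ∑ i, θ i * ((1 - ε) * Hn i + (if i = i₀ then negMulLog ε else 0)) ≤
        ∑ i, θ i * N i ε := by
      refine Finset.sum_le_sum fun i _ => mul_le_mul_of_nonneg_left ?_ (hθ i)
      split_ifs with h
      · subst h
        exact hB _ ε hε0 hε1 hz
      · rw [add_zero]
        exact hC i ε hε0 hε1
    have hcalc : ∑ i, θ i * ((1 - ε) * Hn i + (if i = i₀ then negMulLog ε else 0)) =
        (1 - ε) * M + θ i₀ * negMulLog ε := by
      simp only [mul_add, Finset.sum_add_distrib, mul_ite, mul_zero, Finset.sum_ite_eq',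
        Finset.mem_univ, if_true, hM, Finset.mul_sum]
      congr 1
      exact Finset.sum_congr rfl fun i _ => by ring
    have h1 : (1 - ε) * M + θ i₀ * negMulLog ε ≤ M := by
      rw [← hcalc]
      exact hlow.trans (hopt ε hε0 hε1)
    -- `θ i₀ * negMulLog ε = ε (M + 1)`
    have h2 : θ i₀ * negMulLog ε = ε * (M + 1) := by
      simp only [Real.negMulLog, hlogε]
      field_simp
    rw [h2] at h1
    nlinarith
  refine ⟨hposi, ?_⟩
  -- (b) the score inequality: `s ≤ M + ε C` for all small `ε`
  set s := ∑ i, θ i * (-Real.log (pz i)) with hs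
  set C := ∑ i, θ i * c i with hCdef
  have hC0 : 0 ≤ C := Finset.sum_nonneg fun i _ => mul_nonneg (hθ i) (hc i)
  have hstep : ∀ ε, 0 < ε → ε < 1 → s ≤ M + ε * C := by
    intro ε hε0 hε1
    have hlow : ∑ i, θ i * ((1 - ε) * Hn i + ε * (-Real.log (pz i)) - ε ^ 2 * c i) ≤
        ∑ i, θ i * N i ε := by
      refine Finset.sum_le_sum fun i _ => ?_
      rcases (hθ i).eq_or_lt with h | h
      · rw [← h, zero_mul, zero_mul]
      · exact mul_le_mul_of_nonneg_left (hA i ε hε0 hε1 (hposi i h)) (hθ i)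
    have hcalc : ∑ i, θ i * ((1 - ε) * Hn i + ε * (-Real.log (pz i)) - ε ^ 2 * c i) =
        (1 - ε) * M + ε * s - ε ^ 2 * C := by
      simp only [hM, hs, hCdef, Finset.mul_sum, ← Finset.sum_add_distrib, ← Finset.sum_sub_distrib]
      exact Finset.sum_congr rfl fun i _ => by ring
    have h1 : (1 - ε) * M + ε * s - ε ^ 2 * C ≤ M := by
      rw [← hcalc]
      exact hlow.trans (hopt ε hε0 hε1)
    have h2 : ε * s ≤ ε * (M + ε * C) := by nlinarith
    exact le_of_mul_le_mul_left h2 hε0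
  refine le_of_forall_pos_lt_add fun δ hδ => ?_
  set ε := min (1 / 2 : ℝ) (δ / (2 * (C + 1))) with hε
  have hε0 : 0 < ε := lt_min (by norm_num) (div_pos hδ (by linarith))
  have hε1 : ε < 1 := (min_le_left _ _).trans_lt (by norm_num)
  have hεC : ε * C < δ := by
    have hle : ε ≤ δ / (2 * (C + 1)) := min_le_right _ _
    calc ε * C ≤ δ / (2 * (C + 1)) * C := mul_le_mul_of_nonneg_right hle hC0
      _ < δ := by
        rw [div_mul_eq_mul_div, div_lt_iff₀ (by linarith)]
        nlinarith
  linarith [hstep ε hε0 hε1]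

end Perturb

/-! ## Existence of maximisers of `H_θ` on `P(Φ)` -/

section MaxEntropy

variable {ι κ μ : Type*} [Fintype ι] [Fintype κ] [Fintype μ]

/-- `H_θ` is continuous in `P`. [folklore] -/
theorem continuous_weightedEntropy (θ : Fin 3 → ℝ) :
    Continuous (weightedEntropy (ι := ι) (κ := κ) (μ := μ) θ) := by
  have h1 : Continuous fun P : ι × κ × μ → ℝ => shannonEntropy (marginalDist₁ P) := by
    unfold shannonEntropy marginalDist₁
    refine Continuous.div_const (continuous_finsetSum _ fun a _ =>
      Real.continuous_negMulLog.comp ?_) _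
    exact continuous_finsetSum _ fun b _ => continuous_finsetSum _ fun c _ => continuous_apply _
  have h2 : Continuous fun P : ι × κ × μ → ℝ => shannonEntropy (marginalDist₂ P) := by
    unfold shannonEntropy marginalDist₂
    refine Continuous.div_const (continuous_finsetSum _ fun a _ =>
      Real.continuous_negMulLog.comp ?_) _
    exact continuous_finsetSum _ fun b _ => continuous_finsetSum _ fun c _ => continuous_apply _
  have h3 : Continuous fun P : ι × κ × μ → ℝ => shannonEntropy (marginalDist₃ P) := by
    unfold shannonEntropy marginalDist₃
    refine Continuous.div_const (continuous_finsetSum _ fun a _ =>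
      Real.continuous_negMulLog.comp ?_) _
    exact continuous_finsetSum _ fun b _ => continuous_finsetSum _ fun c _ => continuous_apply _
  unfold weightedEntropy
  exact ((continuous_const.mul h1).add (continuous_const.mul h2)).add (continuous_const.mul h3)

/-- The feasible set `{P ∈ stdSimplex | supp P ⊆ Φ}` of the maximisation defining `H_θ(Φ)` is
compact. [folklore] -/
theorem isCompact_stdSimplex_support_subset (Φ : Set (ι × κ × μ)) :
    IsCompact {P : ι × κ × μ → ℝ | P ∈ stdSimplex ℝ (ι × κ × μ) ∧ Function.support P ⊆ Φ} := by
  have hc : IsClosed {P : ι × κ × μ → ℝ | Function.support P ⊆ Φ} := by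
    have : {P : ι × κ × μ → ℝ | Function.support P ⊆ Φ} = ⋂ x ∈ Φᶜ, {P | P x = 0} := by
      ext P
      simp only [Set.mem_setOf_eq, Function.support_subset_iff', Set.mem_iInter, Set.mem_compl_iff]
    rw [this]
    exact isClosed_biInter fun x _ => isClosed_eq (continuous_apply x) continuous_const
  exact (isCompact_stdSimplex ℝ _).inter_right hc

/-- **A maximiser of `H_θ` on `P(Φ)` exists** for nonempty `Φ` (continuous function on a nonempty
compact set). [cite: ChristandlVranaZuiddam2023, Def. 2.2] -/
theorem exists_isMaxOn_weightedEntropy (θ : Fin 3 → ℝ) {Φ : Set (ι × κ × μ)} (hΦ : Φ.Nonempty) :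
    ∃ P ∈ {P : ι × κ × μ → ℝ | P ∈ stdSimplex ℝ (ι × κ × μ) ∧ Function.support P ⊆ Φ},
      IsMaxOn (weightedEntropy θ)
        {P : ι × κ × μ → ℝ | P ∈ stdSimplex ℝ (ι × κ × μ) ∧ Function.support P ⊆ Φ} P := by
  classical
  obtain ⟨x, hx⟩ := hΦ
  refine (isCompact_stdSimplex_support_subset Φ).exists_isMaxOn
    ⟨Pi.single x 1, single_mem_stdSimplex ℝ x, ?_⟩ (continuous_weightedEntropy θ).continuousOn
  intro y hy
  rw [Function.mem_support, Pi.single_apply] at hy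
  split_ifs at hy with h
  · rw [h]; exact hx
  · exact absurd rfl hy

/-- The image `H_θ(P(Φ))` is bounded above (by `∑ θ(i) log₂ |Iᵢ|`). [folklore] -/
theorem bddAbove_weightedEntropy_image {θ : Fin 3 → ℝ} (hθ : ∀ i, 0 ≤ θ i) (Φ : Set (ι × κ × μ)) :
    BddAbove (weightedEntropy θ ''
      {P : ι × κ × μ → ℝ | P ∈ stdSimplex ℝ (ι × κ × μ) ∧ Function.support P ⊆ Φ}) :=
  ⟨_, by
    rintro _ ⟨P, ⟨hP, -⟩, rfl⟩
    exact weightedEntropy_le hθ hP⟩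

/-- `H_θ(P) ≤ H_θ(Φ)` for every probability distribution `P` supported in `Φ`.
[cite: ChristandlVranaZuiddam2023, Def. 2.2] -/
theorem weightedEntropy_le_maxWeightedEntropy {θ : Fin 3 → ℝ} (hθ : ∀ i, 0 ≤ θ i)
    {Φ : Set (ι × κ × μ)} {P : ι × κ × μ → ℝ} (hP : P ∈ stdSimplex ℝ (ι × κ × μ))
    (hs : Function.support P ⊆ Φ) : weightedEntropy θ P ≤ maxWeightedEntropy θ Φ :=
  le_csSup (bddAbove_weightedEntropy_image hθ Φ) ⟨P, ⟨hP, hs⟩, rfl⟩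

/-- `H_θ(Φ) ≤ θ(1) log₂|ι| + θ(2) log₂|κ| + θ(3) log₂|μ|` (CVZ Thm. 2.4.5 in logarithmic form, for the
standard bases). [cite: ChristandlVranaZuiddam2023, Thm. 2.4.5] -/
theorem maxWeightedEntropy_le_card {θ : Fin 3 → ℝ} (hθ : ∀ i, 0 ≤ θ i) (Φ : Set (ι × κ × μ)) :
    maxWeightedEntropy θ Φ ≤ θ 0 * (Real.log (Fintype.card ι) / Real.log 2) +
      θ 1 * (Real.log (Fintype.card κ) / Real.log 2) +
        θ 2 * (Real.log (Fintype.card μ) / Real.log 2) := by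
  have h2 : 0 ≤ Real.log 2 := Real.log_nonneg one_le_two
  rcases (weightedEntropy θ ''
      {P : ι × κ × μ → ℝ | P ∈ stdSimplex ℝ (ι × κ × μ) ∧ Function.support P ⊆ Φ}).eq_empty_or_nonempty
    with h | h
  · rw [maxWeightedEntropy, h, Real.sSup_empty]
    exact add_nonneg (add_nonneg
      (mul_nonneg (hθ 0) (div_nonneg (Real.log_natCast_nonneg _) h2))
      (mul_nonneg (hθ 1) (div_nonneg (Real.log_natCast_nonneg _) h2)))
      (mul_nonneg (hθ 2) (div_nonneg (Real.log_natCast_nonneg _) h2))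
  · refine csSup_le h ?_
    rintro _ ⟨P, ⟨hP, -⟩, rfl⟩
    exact weightedEntropy_le hθ hP

/-- At a maximiser the supremum `H_θ(Φ)` is attained. [cite: ChristandlVranaZuiddam2023, Def. 2.2] -/
theorem maxWeightedEntropy_eq_of_isMaxOn {θ : Fin 3 → ℝ} {Φ : Set (ι × κ × μ)} {P : ι × κ × μ → ℝ}
    (hP : P ∈ {P : ι × κ × μ → ℝ | P ∈ stdSimplex ℝ (ι × κ × μ) ∧ Function.support P ⊆ Φ})
    (hmax : IsMaxOn (weightedEntropy θ)
      {P : ι × κ × μ → ℝ | P ∈ stdSimplex ℝ (ι × κ × μ) ∧ Function.support P ⊆ Φ} P) :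
    maxWeightedEntropy θ Φ = weightedEntropy θ P :=
  IsGreatest.csSup_eq ⟨⟨P, hP, rfl⟩, by
    rintro _ ⟨P', hP', rfl⟩
    exact hmax hP'⟩

end MaxEntropy

/-! ## First-order conditions at a maximiser -/

section KKT

variable {ι κ μ : Type*} [Fintype ι] [Fintype κ] [Fintype μ]
variable [DecidableEq ι] [DecidableEq κ] [DecidableEq μ]

omit [Fintype ι] in
/-- Marginals of the perturbation `(1-ε) P + ε δ_x`: first marginal. [folklore] -/
theorem marginalDist₁_perturb (P : ι × κ × μ → ℝ) (x : ι × κ × μ) (ε : ℝ) (a : ι) :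
    marginalDist₁ (fun y => (1 - ε) * P y + ε * (if y = x then 1 else 0)) a =
      (1 - ε) * marginalDist₁ P a + ε * (if a = x.1 then 1 else 0) := by
  obtain ⟨x₁, x₂, x₃⟩ := x
  have hsum : ∑ b : κ, ∑ c : μ, (if ((a, b, c) : ι × κ × μ) = (x₁, x₂, x₃) then (1 : ℝ) else 0) =
      if a = x₁ then 1 else 0 := by
    rw [Finset.sum_eq_single x₂, Finset.sum_eq_single x₃]
    · simp
    · intro c _ hc
      rw [if_neg]
      simp [hc]
    · simp
    · intro b _ hb
      refine Finset.sum_eq_zero fun c _ => ?_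
      rw [if_neg]
      simp [hb]
    · simp
  simp only [marginalDist₁, Finset.sum_add_distrib, ← Finset.mul_sum, hsum]

omit [Fintype κ] in
/-- Marginals of the perturbation `(1-ε) P + ε δ_x`: second marginal. [folklore] -/
theorem marginalDist₂_perturb (P : ι × κ × μ → ℝ) (x : ι × κ × μ) (ε : ℝ) (b : κ) :
    marginalDist₂ (fun y => (1 - ε) * P y + ε * (if y = x then 1 else 0)) b =
      (1 - ε) * marginalDist₂ P b + ε * (if b = x.2.1 then 1 else 0) := by
  obtain ⟨x₁, x₂, x₃⟩ := x
  have hsum : ∑ a : ι, ∑ c : μ, (if ((a, b, c) : ι × κ × μ) = (x₁, x₂, x₃) then (1 : ℝ) else 0) =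
      if b = x₂ then 1 else 0 := by
    rw [Finset.sum_eq_single x₁, Finset.sum_eq_single x₃]
    · simp
    · intro c _ hc
      rw [if_neg]
      simp [hc]
    · simp
    · intro a _ ha
      refine Finset.sum_eq_zero fun c _ => ?_
      rw [if_neg]
      simp [ha]
    · simp
  simp only [marginalDist₂, Finset.sum_add_distrib, ← Finset.mul_sum, hsum]

omit [Fintype μ] in
/-- Marginals of the perturbation `(1-ε) P + ε δ_x`: third marginal. [folklore] -/
theorem marginalDist₃_perturb (P : ι × κ × μ → ℝ) (x : ι × κ × μ) (ε : ℝ) (c : μ) :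
    marginalDist₃ (fun y => (1 - ε) * P y + ε * (if y = x then 1 else 0)) c =
      (1 - ε) * marginalDist₃ P c + ε * (if c = x.2.2 then 1 else 0) := by
  obtain ⟨x₁, x₂, x₃⟩ := x
  have hsum : ∑ a : ι, ∑ b : κ, (if ((a, b, c) : ι × κ × μ) = (x₁, x₂, x₃) then (1 : ℝ) else 0) =
      if c = x₃ then 1 else 0 := by
    rw [Finset.sum_eq_single x₁, Finset.sum_eq_single x₂]
    · simp
    · intro b _ hb
      rw [if_neg]
      simp [hb]
    · simp
    · intro a _ ha
      refine Finset.sum_eq_zero fun b _ => ?_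
      rw [if_neg]
      simp [ha]
    · simp
  simp only [marginalDist₃, Finset.sum_add_distrib, ← Finset.mul_sum, hsum]

/-- The perturbation `(1-ε) P + ε δ_x` of a feasible `P` towards a point `x ∈ Φ` is feasible for
`0 ≤ ε ≤ 1`. [folklore] -/
theorem perturb_mem {Φ : Set (ι × κ × μ)} {P : ι × κ × μ → ℝ} (hP : P ∈ stdSimplex ℝ (ι × κ × μ))
    (hs : Function.support P ⊆ Φ) {x : ι × κ × μ} (hx : x ∈ Φ) {ε : ℝ} (hε0 : 0 ≤ ε) (hε1 : ε ≤ 1) :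
    (fun y => (1 - ε) * P y + ε * (if y = x then 1 else 0)) ∈
      {P : ι × κ × μ → ℝ | P ∈ stdSimplex ℝ (ι × κ × μ) ∧ Function.support P ⊆ Φ} := by
  refine ⟨⟨fun y => ?_, ?_⟩, fun y hy => ?_⟩
  · have := hP.1 y
    have : (0 : ℝ) ≤ (if y = x then 1 else 0) := by split_ifs <;> norm_num
    positivity
  · simp only [Finset.sum_add_distrib, ← Finset.mul_sum, hP.2, Finset.sum_ite_eq',
      Finset.mem_univ, if_true]
    ring
  · rw [Function.mem_support] at hy
    by_cases hyx : y = x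
    · rw [hyx]; exact hx
    · rw [if_neg hyx, mul_zero, add_zero] at hy
      exact hs (Function.mem_support.2 (right_ne_zero_of_mul hy))

/-- **First-order conditions at a maximiser of `H_θ` on `P(Φ)`** ([Str91]; the content of
[CVZ23, Prop. 2.6]): if `P` maximises `H_θ = ∑ θ(i) H(Pᵢ)` over the probability distributions
supported in `Φ` and `θ ≥ 0`, then for every `x ∈ Φ`
(a) `θ(i) > 0 ⇒ Pᵢ(xᵢ) > 0` (marginals with positive weight charge every point of the projection of
`Φ`), and (b) the score `∑ᵢ θ(i) log₂(1/Pᵢ(xᵢ))` is at most `H_θ(P)` (with Lean's `log 0 = 0` the terms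
with `θ(i) = 0` vanish). [cite: ChristandlVranaZuiddam2023, Prop. 2.6] -/
theorem IsMaxOn.marginal_pos_and_score_le {θ : Fin 3 → ℝ} (hθ : ∀ i, 0 ≤ θ i) {Φ : Set (ι × κ × μ)}
    {P : ι × κ × μ → ℝ} (hP : P ∈ stdSimplex ℝ (ι × κ × μ)) (hs : Function.support P ⊆ Φ)
    (hmax : IsMaxOn (weightedEntropy θ)
      {P : ι × κ × μ → ℝ | P ∈ stdSimplex ℝ (ι × κ × μ) ∧ Function.support P ⊆ Φ} P)
    {x : ι × κ × μ} (hx : x ∈ Φ) :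
    ((0 < θ 0 → 0 < marginalDist₁ P x.1) ∧ (0 < θ 1 → 0 < marginalDist₂ P x.2.1) ∧
      (0 < θ 2 → 0 < marginalDist₃ P x.2.2)) ∧
    θ 0 * (-Real.log (marginalDist₁ P x.1) / Real.log 2) +
      θ 1 * (-Real.log (marginalDist₂ P x.2.1) / Real.log 2) +
        θ 2 * (-Real.log (marginalDist₃ P x.2.2) / Real.log 2) ≤ weightedEntropy θ P := by
  -- the three marginals of `P` and of its perturbations
  set p₁ := marginalDist₁ P with hp₁
  set p₂ := marginalDist₂ P with hp₂
  set p₃ := marginalDist₃ P with hp₃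
  have hp₁s : p₁ ∈ stdSimplex ℝ ι := marginalDist₁_mem_stdSimplex hP
  have hp₂s : p₂ ∈ stdSimplex ℝ κ := marginalDist₂_mem_stdSimplex hP
  have hp₃s : p₃ ∈ stdSimplex ℝ μ := marginalDist₃_mem_stdSimplex hP
  set Q : ℝ → ι × κ × μ → ℝ := fun ε y => (1 - ε) * P y + ε * (if y = x then 1 else 0) with hQ
  -- abstract data on `Fin 3`
  let Hn : Fin 3 → ℝ := ![∑ a, negMulLog (p₁ a), ∑ b, negMulLog (p₂ b), ∑ c, negMulLog (p₃ c)]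
  let pz : Fin 3 → ℝ := ![p₁ x.1, p₂ x.2.1, p₃ x.2.2]
  let cc : Fin 3 → ℝ :=
    ![∑ y, (if p₁ y = 0 then 0 else ((if y = x.1 then (1 : ℝ) else 0) - p₁ y) ^ 2 / p₁ y),
      ∑ y, (if p₂ y = 0 then 0 else ((if y = x.2.1 then (1 : ℝ) else 0) - p₂ y) ^ 2 / p₂ y),
      ∑ y, (if p₃ y = 0 then 0 else ((if y = x.2.2 then (1 : ℝ) else 0) - p₃ y) ^ 2 / p₃ y)]
  let N : Fin 3 → ℝ → ℝ := ![fun ε => ∑ a, negMulLog (marginalDist₁ (Q ε) a),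
    fun ε => ∑ b, negMulLog (marginalDist₂ (Q ε) b), fun ε => ∑ c, negMulLog (marginalDist₃ (Q ε) c)]
  have hlog2 : 0 < Real.log 2 := Real.log_pos one_lt_two
  -- `H_θ` in terms of the abstract data
  have hwE : ∀ R : ι × κ × μ → ℝ, weightedEntropy θ R * Real.log 2 =
      θ 0 * ∑ a, negMulLog (marginalDist₁ R a) + θ 1 * ∑ b, negMulLog (marginalDist₂ R b) +
        θ 2 * ∑ c, negMulLog (marginalDist₃ R c) := by
    intro R
    simp only [weightedEntropy, shannonEntropy_def]
    field_simp
  have hq₁ : ∀ ε a, marginalDist₁ (Q ε) a = (1 - ε) * p₁ a + ε * (if a = x.1 then 1 else 0) :=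
    fun ε a => marginalDist₁_perturb P x ε a
  have hq₂ : ∀ ε b, marginalDist₂ (Q ε) b = (1 - ε) * p₂ b + ε * (if b = x.2.1 then 1 else 0) :=
    fun ε b => marginalDist₂_perturb P x ε b
  have hq₃ : ∀ ε c, marginalDist₃ (Q ε) c = (1 - ε) * p₃ c + ε * (if c = x.2.2 then 1 else 0) :=
    fun ε c => marginalDist₃_perturb P x ε c
  have key := kkt_of_perturbation_bounds (θ := θ) (Hn := Hn) (pz := pz) (c := cc) (N := N) hθ
    (by
      intro i
      fin_cases i
      · exact hp₁s.1 _
      · exact hp₂s.1 _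
      · exact hp₃s.1 _)
    (by
      intro i
      fin_cases i
      · exact perturb_remainder_nonneg p₁ hp₁s.1 _
      · exact perturb_remainder_nonneg p₂ hp₂s.1 _
      · exact perturb_remainder_nonneg p₃ hp₃s.1 _)
    (by
      have h := weightedEntropy_nonneg hθ hP
      have e : ∑ i, θ i * Hn i = weightedEntropy θ P * Real.log 2 := by
        rw [hwE, Fin.sum_univ_three]
        rfl
      rw [e]
      positivity)
    (by
      intro ε hε0 hε1
      have hmem := perturb_mem hP hs hx hε0.le hε1.le
      have h := hmax hmem
      have h' : weightedEntropy θ (Q ε) * Real.log 2 ≤ weightedEntropy θ P * Real.log 2 :=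
        mul_le_mul_of_nonneg_right h hlog2.le
      rw [hwE, hwE] at h'
      simpa [Fin.sum_univ_three, N, Hn] using h')
    (by
      intro i ε hε0 hε1
      fin_cases i
      · exact sum_negMulLog_perturb_ge hp₁s.1 hε0.le hε1.le (hq₁ ε)
      · exact sum_negMulLog_perturb_ge hp₂s.1 hε0.le hε1.le (hq₂ ε)
      · exact sum_negMulLog_perturb_ge hp₃s.1 hε0.le hε1.le (hq₃ ε))
    (by
      intro i ε hε0 hε1 hz
      fin_cases i
      · exact sum_negMulLog_perturb_ge_of_eq_zero hp₁s.1 hz hε0.le hε1.le (hq₁ ε)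
      · exact sum_negMulLog_perturb_ge_of_eq_zero hp₂s.1 hz hε0.le hε1.le (hq₂ ε)
      · exact sum_negMulLog_perturb_ge_of_eq_zero hp₃s.1 hz hε0.le hε1.le (hq₃ ε))
    (by
      intro i ε hε0 hε1 hz
      fin_cases i
      · exact sum_negMulLog_perturb_ge_of_pos hp₁s.1 hp₁s.2 hz hε0.le hε1 (hq₁ ε)
      · exact sum_negMulLog_perturb_ge_of_pos hp₂s.1 hp₂s.2 hz hε0.le hε1 (hq₂ ε)
      · exact sum_negMulLog_perturb_ge_of_pos hp₃s.1 hp₃s.2 hz hε0.le hε1 (hq₃ ε))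
  obtain ⟨hpos, hscore⟩ := key
  refine ⟨⟨hpos 0, hpos 1, hpos 2⟩, ?_⟩
  have e : ∑ i, θ i * Hn i = weightedEntropy θ P * Real.log 2 := by
    rw [hwE, Fin.sum_univ_three]
    rfl
  rw [e, Fin.sum_univ_three] at hscore
  have hfin : θ 0 * (-Real.log (p₁ x.1)) + θ 1 * (-Real.log (p₂ x.2.1)) +
      θ 2 * (-Real.log (p₃ x.2.2)) ≤ weightedEntropy θ P * Real.log 2 := hscore
  calc θ 0 * (-Real.log (p₁ x.1) / Real.log 2) + θ 1 * (-Real.log (p₂ x.2.1) / Real.log 2) +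
        θ 2 * (-Real.log (p₃ x.2.2) / Real.log 2)
      = (θ 0 * (-Real.log (p₁ x.1)) + θ 1 * (-Real.log (p₂ x.2.1)) +
          θ 2 * (-Real.log (p₃ x.2.2))) / Real.log 2 := by ring
    _ ≤ weightedEntropy θ P * Real.log 2 / Real.log 2 := div_le_div_of_nonneg_right hfin hlog2.le
    _ = weightedEntropy θ P := mul_div_cancel_right₀ _ hlog2.ne'

omit [DecidableEq ι] [DecidableEq κ] [DecidableEq μ] in
/-- **Gibbs' inequality for the weighted marginal entropy:** for a probability distribution `P` on
`ι × κ × μ` and nonnegative sub-probability vectors `Q₁, Q₂, Q₃` on the three factors such that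
`Qᵢ(yᵢ) > 0` whenever `P(y) > 0` and `θ(i) > 0`,
`H_θ(P) ≤ ∑_y P(y) ∑ᵢ θ(i) log₂ (1/Qᵢ(yᵢ))`. [folklore] -/
theorem weightedEntropy_le_sum_mul_score {θ : Fin 3 → ℝ} (hθ : ∀ i, 0 ≤ θ i) {P : ι × κ × μ → ℝ}
    (hP : P ∈ stdSimplex ℝ (ι × κ × μ)) {Q₁ : ι → ℝ} {Q₂ : κ → ℝ} {Q₃ : μ → ℝ}
    (hQ₁0 : ∀ a, 0 ≤ Q₁ a) (hQ₁1 : ∑ a, Q₁ a ≤ 1) (hQ₂0 : ∀ b, 0 ≤ Q₂ b) (hQ₂1 : ∑ b, Q₂ b ≤ 1)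
    (hQ₃0 : ∀ c, 0 ≤ Q₃ c) (hQ₃1 : ∑ c, Q₃ c ≤ 1)
    (hpos : ∀ y, P y ≠ 0 →
      (0 < θ 0 → 0 < Q₁ y.1) ∧ (0 < θ 1 → 0 < Q₂ y.2.1) ∧ (0 < θ 2 → 0 < Q₃ y.2.2)) :
    weightedEntropy θ P ≤ ∑ y, P y * (θ 0 * (-Real.log (Q₁ y.1) / Real.log 2) +
      θ 1 * (-Real.log (Q₂ y.2.1) / Real.log 2) + θ 2 * (-Real.log (Q₃ y.2.2) / Real.log 2)) := by
  have h1 : θ 0 * shannonEntropy (marginalDist₁ P) ≤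
      ∑ y, P y * (θ 0 * (-Real.log (Q₁ y.1) / Real.log 2)) := by
    have e : ∑ y, P y * (θ 0 * (-Real.log (Q₁ y.1) / Real.log 2)) =
        θ 0 * ∑ a, marginalDist₁ P a * (-Real.log (Q₁ a) / Real.log 2) := by
      simp only [marginalDist₁, Finset.sum_mul, Finset.mul_sum, Fintype.sum_prod_type]
      exact Finset.sum_congr rfl fun a _ => Finset.sum_congr rfl fun b _ =>
        Finset.sum_congr rfl fun c _ => by ring
    rw [e]
    rcases (hθ 0).eq_or_lt with h | h
    · rw [← h, zero_mul, zero_mul]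
    · refine mul_le_mul_of_nonneg_left ?_ (hθ 0)
      have hm := marginalDist₁_mem_stdSimplex hP
      refine shannonEntropy_le_sum_mul_neg_logb hm.1 hm.2 hQ₁0 hQ₁1 fun a ha => ?_
      obtain ⟨b, -, hb⟩ := Finset.exists_ne_zero_of_sum_ne_zero ha
      obtain ⟨c, -, hc⟩ := Finset.exists_ne_zero_of_sum_ne_zero hb
      exact (hpos (a, b, c) hc).1 h
  have h2 : θ 1 * shannonEntropy (marginalDist₂ P) ≤
      ∑ y, P y * (θ 1 * (-Real.log (Q₂ y.2.1) / Real.log 2)) := by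
    have e : ∑ y, P y * (θ 1 * (-Real.log (Q₂ y.2.1) / Real.log 2)) =
        θ 1 * ∑ b, marginalDist₂ P b * (-Real.log (Q₂ b) / Real.log 2) := by
      simp only [marginalDist₂, Finset.sum_mul, Finset.mul_sum, Fintype.sum_prod_type]
      rw [Finset.sum_comm]
      exact Finset.sum_congr rfl fun b _ => Finset.sum_congr rfl fun a _ =>
        Finset.sum_congr rfl fun c _ => by ring
    rw [e]
    rcases (hθ 1).eq_or_lt with h | h
    · rw [← h, zero_mul, zero_mul]
    · refine mul_le_mul_of_nonneg_left ?_ (hθ 1)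
      have hm := marginalDist₂_mem_stdSimplex hP
      refine shannonEntropy_le_sum_mul_neg_logb hm.1 hm.2 hQ₂0 hQ₂1 fun b hb => ?_
      obtain ⟨a, -, ha⟩ := Finset.exists_ne_zero_of_sum_ne_zero hb
      obtain ⟨c, -, hc⟩ := Finset.exists_ne_zero_of_sum_ne_zero ha
      exact (hpos (a, b, c) hc).2.1 h
  have h3 : θ 2 * shannonEntropy (marginalDist₃ P) ≤
      ∑ y, P y * (θ 2 * (-Real.log (Q₃ y.2.2) / Real.log 2)) := by
    have e : ∑ y, P y * (θ 2 * (-Real.log (Q₃ y.2.2) / Real.log 2)) =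
        θ 2 * ∑ c, marginalDist₃ P c * (-Real.log (Q₃ c) / Real.log 2) := by
      simp only [marginalDist₃, Finset.sum_mul, Finset.mul_sum, Fintype.sum_prod_type]
      calc ∑ a, ∑ b, ∑ c, P (a, b, c) * (θ 2 * (-Real.log (Q₃ c) / Real.log 2))
          = ∑ a, ∑ c, ∑ b, P (a, b, c) * (θ 2 * (-Real.log (Q₃ c) / Real.log 2)) :=
            Finset.sum_congr rfl fun a _ => Finset.sum_comm
        _ = ∑ c, ∑ a, ∑ b, P (a, b, c) * (θ 2 * (-Real.log (Q₃ c) / Real.log 2)) := Finset.sum_comm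
        _ = _ := Finset.sum_congr rfl fun c _ => Finset.sum_congr rfl fun a _ =>
            Finset.sum_congr rfl fun b _ => by ring
    rw [e]
    rcases (hθ 2).eq_or_lt with h | h
    · rw [← h, zero_mul, zero_mul]
    · refine mul_le_mul_of_nonneg_left ?_ (hθ 2)
      have hm := marginalDist₃_mem_stdSimplex hP
      refine shannonEntropy_le_sum_mul_neg_logb hm.1 hm.2 hQ₃0 hQ₃1 fun c hc => ?_
      obtain ⟨a, -, ha⟩ := Finset.exists_ne_zero_of_sum_ne_zero hc
      obtain ⟨b, -, hb⟩ := Finset.exists_ne_zero_of_sum_ne_zero ha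
      exact (hpos (a, b, c) hb).2.2 h
  calc weightedEntropy θ P
      = θ 0 * shannonEntropy (marginalDist₁ P) + θ 1 * shannonEntropy (marginalDist₂ P) +
          θ 2 * shannonEntropy (marginalDist₃ P) := rfl
    _ ≤ ∑ y, P y * (θ 0 * (-Real.log (Q₁ y.1) / Real.log 2)) +
          ∑ y, P y * (θ 1 * (-Real.log (Q₂ y.2.1) / Real.log 2)) +
          ∑ y, P y * (θ 2 * (-Real.log (Q₃ y.2.2) / Real.log 2)) := add_le_add (add_le_add h1 h2) h3
    _ = _ := by
        rw [← Finset.sum_add_distrib, ← Finset.sum_add_distrib]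
        exact Finset.sum_congr rfl fun y _ => by ring

end KKT

end Literature.Computability.AlgebraicComplexity

end
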